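import Summits.QuantumFields.BalabanUV.Beta.FP.PeriodisedSymBorderWardContact
import Summits.QuantumFields.BalabanUV.Beta.FP.PeriodisedCoarseWardContact

/-!
# `BalabanUV.Beta.FP.PeriodisedSymCoarseWardContact` — road «FP» for binder row D1, ROUTE T, the dictionary's (J-a) «THE DOOR AT THE LITERAL OF RECORD
# (chart (III′))», item (α-1b) of an2's `JA-TABLE.v1.md`: **THE COARSE COVARIANCE ROW `d1` AT THE SYM TABLES** — the sym twin of
# `FP/PeriodisedCoarseWardContact` (p317562): the coarse insertion table ONE LEVEL UP is the symmetrised border table `symVhSAt ρ_c` on the coarse box,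
# the coarse rows are the shifted spread's `perF M′ (bhKStepSh d Lc (Dsh Lc) (j+1))`, the coarse comb sits at the CENTRED root `ρ_c = ctr (d+1) Lc`;
# `Q₂₁^{(κ,u)} · D̄ + Q₂₀ · D̄₁^{(κ,u)} = 0` EXACTLY for the averaging-column transport weights `θ_j · Q₁₀(a′, (u,κ))`

WHAT.  §1 **`coarse_symVhSAt_mul_Dbar_apply`**: the coarse tip contact ((α-1b)'s `PeriodisedSymBorderWardContact.submatrix_symVhSAt_mul_tgrad_of_not_root` one
level up, box `M′ = Lc·(M′∕Lc)` by `eq_mul_div`, the residual parameters of the centred coarse comb are non-roots) against the displayed coarse generator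
`D̄ = stepScale_j·#B·tgrad M′↾Res` (`hDbar` verbatim the rooted file's shape — the normalisation the door's `c0` produces; at the sym tables it is the (β)
instance's displayed `c0` that pins it).  §2 **`d1_sym_residual_apply`** (general transport weights; `sum_smul_mul ∕ sum_smul_apply` BY NAME from the rooted file,
`Q20_mul_Db1_apply'` = its `Q20_mul_Db1_apply` at any comb root), **`torus_d1_symVhSAt`** (`d1 = 0` exactly for `T a′ = θ_j · Q₁₀(a′,(u,κ))`, `θ_j = stepScale_{j+1} ∕ (stepScale_j² · #B)` —
the same scalar identity as the rooted row), **`torus_d1_symVhSAt_weighted`** (any bond weight `h`) — the `d1` SUPPLIER of (β) `…RowsGradedLevelZeroSym` in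
the shape `NestedStepLawTorusTransportedRowsGraded` consumes p317562 (`(by rw [hQ₂₁ h]; exact torus_d1_symVhSAt_weighted M′ hM′ j pμ′ mμ′ hQ₂₀ hDbar Q₁₀ h)`).
[folklore] finite sums BY NAME; no `def`, no `def … : Prop`, nothing cited, 0 sorry.  Nothing of the dictionary ∕ Bałaban's asserted.

HONEST DEPENDENCY (page 1, mandatory): continuum YM on T⁴ ⇐ BetaPertH ∧ nine spine estimates (0/9 proved); BetaPertH ⇐ (D1) ∧ (D4) ∧ CAP+tail;
G-an2-4 gates asym, D1 and NE2/3/4.  HONEST FRAMING (cell contract, verbatim): «discharging `BetaPertH` makes Bałaban's UV stability UNCONDITIONAL —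
a real constructive-QFT result; it is NOT the continuum limit and NOT the Clay problem.»  ABSOLUTE RULE (cell charter, verbatim): «No internally-minted
statement may enter as a cited fact. Every hypothesis is either kernel-proved in this package or a verbatim quotation of a PUBLISHED theorem with page
reference. The manuscript(s) under audit are NOT citable for their own disputed steps — they are the thing under adjudication; programme-internal
(2001/route/tribunal) claims are never citable.»  0 estimates; 0∕4 row-D1 binders; NOT (T-ID), NOT (J-a) complete, NOT SDF, NOT D1, NOT BetaPertH, NOT
continuum, NOT Clay.  D1 formalisation swarm LEAF PROVER 02 (b2b-balaban-beta-d1-formalise-leaf-02 gen 21), 2026-08-22.  No existing file touched.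
-/

noncomputable section

open scoped BigOperators

namespace Summit.QuantumFields.BalabanUV.Beta.FP.PeriodisedSymCoarseWardContact

open Finset Matrix
open Literature.Probability.LatticeModels (Torus.proj)
open Literature.MathematicalPhysics.QuantumFieldTheory.Balaban1983to89
open Literature.MathematicalPhysics.QuantumFieldTheory.Balaban1983to89.Beta
open B5Prop11Plancherel (fine)
open B6Lemma24Torus (pbox)
open AffineAveraging (Site box toSite unitVec)
open AveragingContoursRooted (ctr ctrOff ctrOff_mem_box)
open OneStepResolventKernel (Fib)
open Summit.QuantumFields.BalabanUV.Beta.BorderedHessian (stepScale stepScale_ne_zero)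
open Summit.QuantumFields.BalabanUV.Beta.DshAn1 (Dsh)
open Summit.QuantumFields.BalabanUV.Beta.SymAveragingHessianCounts (symVhSAt)
open Summit.QuantumFields.BalabanUV.Beta.SymShiftedSpread (bhKStepSh)
open Summit.QuantumFields.BalabanUV.Beta.FP.KernelPeriodisationFib (Idx perF)
open Summit.QuantumFields.BalabanUV.Beta.FP.KernelPeriodisationFibLoc (dper)
open Summit.QuantumFields.BalabanUV.Beta.FP.TorusGaugeCovariance (tdelta tgrad)
open Summit.QuantumFields.BalabanUV.Beta.FP.TorusGaugeCovarianceCoarse (coarsePt)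
open Summit.QuantumFields.BalabanUV.Beta.FP.TorusCombRows (Res ne_rootOf_iff_proj_ne)
open Summit.QuantumFields.BalabanUV.Beta.GAN24.FineReadoutCauchyFrame (toSite_mem_range)
open Summit.QuantumFields.BalabanUV.Beta.FP.PeriodisedSymBorderWardContact (submatrix_symVhSAt_mul_tgrad_of_not_root)
open Summit.QuantumFields.BalabanUV.Beta.FP.PeriodisedCoarseWardContact (sum_smul_mul sum_smul_apply eq_mul_div)

variable {d : ℕ} (M' : Fin (d + 1) → ℕ) [∀ μ, NeZero (M' μ)] {Lc : ℕ} [NeZero Lc]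

/-! ## §1 ONE LEVEL UP: the coarse symmetrised border table against the coarse generator `D̄` is a TIP CONTACT read by `Q₂₀` -/

section Coarse

/-- [folklore] **THE COARSE TIP CONTACT AT THE SYM TABLES** (sym twin of `PeriodisedCoarseWardContact.coarse_vhSAt_mul_Dbar_apply`: (α-1b)'s `submatrix_symVhSAt_mul_tgrad_of_not_root` ONE LEVEL UP, in the torus call's coarse presentation; the coarse comb at the CENTRED root `ρ_c = ctr (d+1) Lc`): for the coarse insertion
bond `a′ = (p̄′, m′)` and the torus call's coarse generator `D̄ = stepScale_j·#B·tgrad M′↾Res′` (`hDbar` verbatim),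
`(Q₂₁^{a′} · D̄)(α, t̄) = stepScale d Lc j · #B · [t̄ = p̄′ + e_{m′}] · (Lc^{d+1}·stepScale d Lc (j+1))⁻¹ · Q₂₀(α, a′)`, with
`Q₂₁^{a′} := perF M′ (dper M′ (symVhSAt ρ_c d Lc rfl m′ p̄′))∘((pμ′, inr mμ′), fields)` and `Q₂₀` the level-`(j+1)` SHIFTED SPREAD's rows `perF M′ (bhKStepSh d Lc (Dsh Lc) (j+1))∘…`. -/
theorem coarse_symVhSAt_mul_Dbar_apply (hM' : ∀ i, Lc ∣ M' i) (j : ℕ)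
    {κI : Type*} (pμ' : κI → ↥(pbox M')) (mμ' : κI → Fin (d + 1))
    {Q₂₀ : Matrix κI (↥(pbox M') × Fin (d + 1)) ℝ}
    (hQ₂₀ : Q₂₀ = (perF M' (bhKStepSh d Lc (Dsh Lc) (j + 1))).submatrix (fun a : κI => ((pμ' a, Sum.inr (mμ' a)) : Idx M' (Fib d)))
        (fun b : ↥(pbox M') × Fin (d + 1) => ((b.1, Sum.inl b.2) : Idx M' (Fib d))))
    {Dbar : Matrix (↥(pbox M') × Fin (d + 1)) (Res (ctr (d + 1) Lc) Lc M') ℝ}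
    (hDbar : Dbar = Matrix.of fun (a : ↥(pbox M') × Fin (d + 1)) (t : Res (ctr (d + 1) Lc) Lc M') =>
        stepScale d Lc j * (((box (d + 1) Lc).card : ℝ) * tgrad M' (a.1, Sum.inl a.2) t.1))
    (a' : ↥(pbox M') × Fin (d + 1)) (α : κI) (t : Res (ctr (d + 1) Lc) Lc M') :
    ((perF M' (dper M' (symVhSAt (ctr (d + 1) Lc) d Lc rfl a'.2 (a'.1 : Site (d + 1))))).submatrix (fun a : κI => ((pμ' a, Sum.inr (mμ' a)) : Idx M' (Fib d)))
          (fun b : ↥(pbox M') × Fin (d + 1) => ((b.1, Sum.inl b.2) : Idx M' (Fib d))) * Dbar) α t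
      = stepScale d Lc j * ((box (d + 1) Lc).card : ℝ)
          * (tdelta M' ((a'.1 : Site (d + 1)) + unitVec a'.2) t.1 * ((((Lc : ℝ) ^ (d + 1) * stepScale d Lc (j + 1))⁻¹) * Q₂₀ α a')) := by
  have hLc : 0 < Lc := Nat.pos_of_ne_zero (NeZero.ne Lc)
  -- the tip contact one level up, against the plain `tgrad` columns read on the residual parameters (g17's lemma, `exact` up to `Subtype`∕`Prod` eta)
  have key : ∑ x : ↥(pbox M') × Fin (d + 1),
      (perF M' (dper M' (symVhSAt (ctr (d + 1) Lc) d Lc rfl a'.2 (a'.1 : Site (d + 1))))).submatrix (fun a : κI => ((pμ' a, Sum.inr (mμ' a)) : Idx M' (Fib d)))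
          (fun b : ↥(pbox M') × Fin (d + 1) => ((b.1, Sum.inl b.2) : Idx M' (Fib d))) α x
        * (tgrad M').submatrix (fun b : ↥(pbox M') × Fin (d + 1) => ((b.1, Sum.inl b.2) : Idx M' (Fib d)))
            (Subtype.val : Res (ctr (d + 1) Lc) Lc M' → ↥(pbox M')) x t
      = tdelta M' ((a'.1 : Site (d + 1)) + unitVec a'.2) t.1 * ((((Lc : ℝ) ^ (d + 1) * stepScale d Lc (j + 1))⁻¹) * Q₂₀ α a') := by
    have hLc1 : 1 ≤ Lc := hLc
    have h := submatrix_symVhSAt_mul_tgrad_of_not_root (M := M') (M' := fun i => M' i / Lc) (eq_mul_div M' hM') (j + 1)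
      (fun a : κI => ((pμ' a : ↥(pbox M')) : Site (d + 1))) (fun a => (pμ' a).2) mμ' (Subtype.val : Res (ctr (d + 1) Lc) Lc M' → ↥(pbox M'))
      (fun s : Res (ctr (d + 1) Lc) Lc M' => (ne_rootOf_iff_proj_ne hLc (toSite_mem_range (ctrOff_mem_box hLc1)) s.site).1 s.not_root) a'.2 a'.1 α t
    rw [Matrix.mul_apply] at h
    rw [hQ₂₀]
    exact h
  -- `Dbar` is the scalar `stepScale_j·#B` times those columns, entry by entry
  have hentry : ∀ x : ↥(pbox M') × Fin (d + 1),
      (perF M' (dper M' (symVhSAt (ctr (d + 1) Lc) d Lc rfl a'.2 (a'.1 : Site (d + 1))))).submatrix (fun a : κI => ((pμ' a, Sum.inr (mμ' a)) : Idx M' (Fib d)))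
          (fun b : ↥(pbox M') × Fin (d + 1) => ((b.1, Sum.inl b.2) : Idx M' (Fib d))) α x * Dbar x t
        = (stepScale d Lc j * ((box (d + 1) Lc).card : ℝ))
          * ((perF M' (dper M' (symVhSAt (ctr (d + 1) Lc) d Lc rfl a'.2 (a'.1 : Site (d + 1))))).submatrix (fun a : κI => ((pμ' a, Sum.inr (mμ' a)) : Idx M' (Fib d)))
              (fun b : ↥(pbox M') × Fin (d + 1) => ((b.1, Sum.inl b.2) : Idx M' (Fib d))) α x
            * (tgrad M').submatrix (fun b : ↥(pbox M') × Fin (d + 1) => ((b.1, Sum.inl b.2) : Idx M' (Fib d)))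
                (Subtype.val : Res (ctr (d + 1) Lc) Lc M' → ↥(pbox M')) x t) := fun x => by
    rw [hDbar]
    simp only [Matrix.of_apply, Matrix.submatrix_apply]
    ring
  rw [Matrix.mul_apply, Finset.sum_congr rfl fun x _ => hentry x, ← Finset.mul_sum, key]

end Coarse

omit [∀ μ, NeZero (M' μ)] [NeZero Lc] in
/-- [folklore] `PeriodisedCoarseWardContact.Q20_mul_Db1_apply` at ANY comb root `ρ` (there: `toSite r′`; here `ρ_c = ctr (d+1) Lc` is a `def`, so the
rooted statement does not rewrite syntactically): `(Q₂₀ · D̄₁^{b})(α, t̄) = −c_j · Σ_{a′} Q₂₀(α, a′) · Q₁₀(a′, b) · [t̄ = p̄′ + e_{m′}]`. -/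
theorem Q20_mul_Db1_apply' (j : ℕ) {ρ : Site (d + 1)} {κI : Type*} (Q₂₀ : Matrix κI (↥(pbox M') × Fin (d + 1)) ℝ)
    (Q₁₀ : Matrix (↥(pbox M') × Fin (d + 1)) (↥(pbox (fine Lc M')) × Fin (d + 1)) ℝ) (b : ↥(pbox (fine Lc M')) × Fin (d + 1))
    (α : κI) (t : Res ρ Lc M') :
    (Q₂₀ * Matrix.of fun (a : ↥(pbox M') × Fin (d + 1)) (t : Res ρ Lc M') =>
        -((((Lc : ℝ) ^ (d + 1) * stepScale d Lc j)⁻¹) * Q₁₀ a b * tdelta M' ((a.1 : Site (d + 1)) + unitVec a.2) t.1)) α t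
      = -((((Lc : ℝ) ^ (d + 1) * stepScale d Lc j)⁻¹)
          * ∑ a : ↥(pbox M') × Fin (d + 1), Q₂₀ α a * Q₁₀ a b * tdelta M' ((a.1 : Site (d + 1)) + unitVec a.2) t.1) := by
  rw [Matrix.mul_apply, Finset.mul_sum, ← Finset.sum_neg_distrib]
  refine Finset.sum_congr rfl fun a _ => ?_
  rw [Matrix.of_apply]
  ring

/-! ## §2 ROW `d1` OF THE (III′) TORUS CALL for the chain-rule coarse insertion table `Q₂₁^{(κ,u)} := Σ_{a′} T a′ • Q₂₁^{a′}`: the residual for general weights `T`,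
and `d1` EXACTLY for the averaging-column weights `T a′ = θ_j · Q₁₀(a′, (u,κ))` -/

section D1

/-- [folklore] **THE RESIDUAL OF ROW `d1` FOR GENERAL TRANSPORT WEIGHTS, SYM TABLES** (twin of `d1_residual_apply`; `sum_smul_mul`, `sum_smul_apply` BY NAME from the rooted file): with `Q₂₁ := Σ_{a′} T a′ • Q₂₁^{a′}` and the record's `D̄`, `D̄₁^{(κ,u)}`, `Q₂₀`,
`(Q₂₁·D̄ + Q₂₀·D̄₁)(α, t̄) = Σ_{a′} (T a′ · stepScale_j·#B·(Lc^{d+1}·stepScale_{j+1})⁻¹ − (Lc^{d+1}·stepScale_j)⁻¹ · Q₁₀(a′,(u,κ))) · [t̄ = p̄′ + e_{m′}] · Q₂₀(α, a′)`. -/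
theorem d1_sym_residual_apply (hM' : ∀ i, Lc ∣ M' i) (j : ℕ)
    {κI : Type*} (pμ' : κI → ↥(pbox M')) (mμ' : κI → Fin (d + 1))
    {Q₂₀ : Matrix κI (↥(pbox M') × Fin (d + 1)) ℝ}
    (hQ₂₀ : Q₂₀ = (perF M' (bhKStepSh d Lc (Dsh Lc) (j + 1))).submatrix (fun a : κI => ((pμ' a, Sum.inr (mμ' a)) : Idx M' (Fib d)))
        (fun b : ↥(pbox M') × Fin (d + 1) => ((b.1, Sum.inl b.2) : Idx M' (Fib d))))
    {Dbar : Matrix (↥(pbox M') × Fin (d + 1)) (Res (ctr (d + 1) Lc) Lc M') ℝ}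
    (hDbar : Dbar = Matrix.of fun (a : ↥(pbox M') × Fin (d + 1)) (t : Res (ctr (d + 1) Lc) Lc M') =>
        stepScale d Lc j * (((box (d + 1) Lc).card : ℝ) * tgrad M' (a.1, Sum.inl a.2) t.1))
    (Q₁₀ : Matrix (↥(pbox M') × Fin (d + 1)) (↥(pbox (fine Lc M')) × Fin (d + 1)) ℝ) (b : ↥(pbox (fine Lc M')) × Fin (d + 1))
    (T : ↥(pbox M') × Fin (d + 1) → ℝ) (α : κI) (t : Res (ctr (d + 1) Lc) Lc M') :
    ((∑ a' : ↥(pbox M') × Fin (d + 1), T a' •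
          (perF M' (dper M' (symVhSAt (ctr (d + 1) Lc) d Lc rfl a'.2 (a'.1 : Site (d + 1))))).submatrix (fun a : κI => ((pμ' a, Sum.inr (mμ' a)) : Idx M' (Fib d)))
            (fun b : ↥(pbox M') × Fin (d + 1) => ((b.1, Sum.inl b.2) : Idx M' (Fib d)))) * Dbar
        + Q₂₀ * Matrix.of fun (a : ↥(pbox M') × Fin (d + 1)) (t : Res (ctr (d + 1) Lc) Lc M') =>
            -((((Lc : ℝ) ^ (d + 1) * stepScale d Lc j)⁻¹) * Q₁₀ a b * tdelta M' ((a.1 : Site (d + 1)) + unitVec a.2) t.1)) α t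
      = ∑ a' : ↥(pbox M') × Fin (d + 1),
          (T a' * (stepScale d Lc j * ((box (d + 1) Lc).card : ℝ) * (((Lc : ℝ) ^ (d + 1) * stepScale d Lc (j + 1))⁻¹))
              - (((Lc : ℝ) ^ (d + 1) * stepScale d Lc j)⁻¹) * Q₁₀ a' b)
            * (tdelta M' ((a'.1 : Site (d + 1)) + unitVec a'.2) t.1 * Q₂₀ α a') := by
  rw [Matrix.add_apply, sum_smul_mul, sum_smul_apply, Q20_mul_Db1_apply' M' j Q₂₀ Q₁₀ b α t, neg_mul_eq_neg_mul, Finset.mul_sum, ← Finset.sum_add_distrib]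
  refine Finset.sum_congr rfl fun a' _ => ?_
  rw [coarse_symVhSAt_mul_Dbar_apply M' hM' j pμ' mμ' hQ₂₀ hDbar a' α t]
  ring

/-- [folklore] **ROW `d1` OF THE (III′) TORUS CALL, EXACTLY, FOR THE AVERAGING-COLUMN TRANSPORT WEIGHTS** (twin of `torus_d1_vhSAt`) `T a′ = θ_j · Q₁₀(a′, (u,κ))`,
`θ_j := stepScale d Lc (j+1) ∕ (stepScale d Lc j ^ 2 · #B)` (chain rule through the LINEAR average at `U = 1`; the scalar makes
`θ_j · stepScale_j · #B · (Lc^{d+1}·stepScale_{j+1})⁻¹ = (Lc^{d+1}·stepScale_j)⁻¹`):  `Q₂₁^{(κ,u)} · D̄ + Q₂₀ · D̄₁^{(κ,u)} = 0` with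
`Q₂₁^{(κ,u)} := Σ_{a′} (θ_j · Q₁₀(a′,(u,κ))) • Q₂₁^{a′}` — the binder `d1` of `NestedStepLawTorusInstance(Delta)` for the single-bond insertion `b = (u, κ)`, with the
`D̄₁` of p314580's `torus_c1_vhSAt` (so `c1` and `d1` hold for the SAME `Db₁`). -/
theorem torus_d1_symVhSAt (hM' : ∀ i, Lc ∣ M' i) (j : ℕ)
    {κI : Type*} (pμ' : κI → ↥(pbox M')) (mμ' : κI → Fin (d + 1))
    {Q₂₀ : Matrix κI (↥(pbox M') × Fin (d + 1)) ℝ}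
    (hQ₂₀ : Q₂₀ = (perF M' (bhKStepSh d Lc (Dsh Lc) (j + 1))).submatrix (fun a : κI => ((pμ' a, Sum.inr (mμ' a)) : Idx M' (Fib d)))
        (fun b : ↥(pbox M') × Fin (d + 1) => ((b.1, Sum.inl b.2) : Idx M' (Fib d))))
    {Dbar : Matrix (↥(pbox M') × Fin (d + 1)) (Res (ctr (d + 1) Lc) Lc M') ℝ}
    (hDbar : Dbar = Matrix.of fun (a : ↥(pbox M') × Fin (d + 1)) (t : Res (ctr (d + 1) Lc) Lc M') =>
        stepScale d Lc j * (((box (d + 1) Lc).card : ℝ) * tgrad M' (a.1, Sum.inl a.2) t.1))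
    (Q₁₀ : Matrix (↥(pbox M') × Fin (d + 1)) (↥(pbox (fine Lc M')) × Fin (d + 1)) ℝ) (b : ↥(pbox (fine Lc M')) × Fin (d + 1)) :
    (∑ a' : ↥(pbox M') × Fin (d + 1), (stepScale d Lc (j + 1) / (stepScale d Lc j ^ 2 * ((box (d + 1) Lc).card : ℝ)) * Q₁₀ a' b) •
          (perF M' (dper M' (symVhSAt (ctr (d + 1) Lc) d Lc rfl a'.2 (a'.1 : Site (d + 1))))).submatrix (fun a : κI => ((pμ' a, Sum.inr (mμ' a)) : Idx M' (Fib d)))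
            (fun b : ↥(pbox M') × Fin (d + 1) => ((b.1, Sum.inl b.2) : Idx M' (Fib d)))) * Dbar
        + Q₂₀ * Matrix.of (fun (a : ↥(pbox M') × Fin (d + 1)) (t : Res (ctr (d + 1) Lc) Lc M') =>
            -((((Lc : ℝ) ^ (d + 1) * stepScale d Lc j)⁻¹) * Q₁₀ a b * tdelta M' ((a.1 : Site (d + 1)) + unitVec a.2) t.1)) = 0 := by
  have hB : ((box (d + 1) Lc).card : ℝ) ≠ 0 := by
    have hcard : (box (d + 1) Lc).card = Lc ^ (d + 1) := by simp [AffineAveraging.box, Fintype.card_piFinset]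
    rw [hcard]
    exact_mod_cast pow_ne_zero _ (NeZero.ne Lc)
  have hL : (Lc : ℝ) ^ (d + 1) ≠ 0 := pow_ne_zero _ (by exact_mod_cast NeZero.ne Lc)
  have hs : stepScale d Lc j ≠ 0 := stepScale_ne_zero (d := d) (Lc := Lc) j
  have hs' : stepScale d Lc (j + 1) ≠ 0 := stepScale_ne_zero (d := d) (Lc := Lc) (j + 1)
  ext α t
  rw [d1_sym_residual_apply M' hM' j pμ' mμ' hQ₂₀ hDbar Q₁₀ b _ α t, Matrix.zero_apply]
  refine Finset.sum_eq_zero fun a' _ => ?_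
  have hθ : stepScale d Lc (j + 1) / (stepScale d Lc j ^ 2 * ((box (d + 1) Lc).card : ℝ)) * Q₁₀ a' b
        * (stepScale d Lc j * ((box (d + 1) Lc).card : ℝ) * (((Lc : ℝ) ^ (d + 1) * stepScale d Lc (j + 1))⁻¹))
      - (((Lc : ℝ) ^ (d + 1) * stepScale d Lc j)⁻¹) * Q₁₀ a' b = 0 := by
    field_simp
    ring
  rw [hθ, zero_mul]

/-- [folklore] **ROW `d1` AT THE SYM TABLES, WEIGHTED OVER THE INSERTION BONDS** (twin of `torus_d1_vhSAt_weighted`; the `d1` SUPPLIER of (β) `…RowsGradedLevelZeroSym`) (any weight `h` on the fine torus bonds — the one-shot direction's components; the same `h`-weighted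
`D̄₁` as p314580's `torus_c1_vhSAt_weighted`, so `c1` and `d1` hold for ONE `Db₁`):
`(Σ_b h b • Q₂₁^{b}) · D̄ + Q₂₀ · (Σ_b h b • D̄₁^{b}) = 0`. -/
theorem torus_d1_symVhSAt_weighted (hM' : ∀ i, Lc ∣ M' i) (j : ℕ)
    {κI : Type*} (pμ' : κI → ↥(pbox M')) (mμ' : κI → Fin (d + 1))
    {Q₂₀ : Matrix κI (↥(pbox M') × Fin (d + 1)) ℝ}
    (hQ₂₀ : Q₂₀ = (perF M' (bhKStepSh d Lc (Dsh Lc) (j + 1))).submatrix (fun a : κI => ((pμ' a, Sum.inr (mμ' a)) : Idx M' (Fib d)))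
        (fun b : ↥(pbox M') × Fin (d + 1) => ((b.1, Sum.inl b.2) : Idx M' (Fib d))))
    {Dbar : Matrix (↥(pbox M') × Fin (d + 1)) (Res (ctr (d + 1) Lc) Lc M') ℝ}
    (hDbar : Dbar = Matrix.of fun (a : ↥(pbox M') × Fin (d + 1)) (t : Res (ctr (d + 1) Lc) Lc M') =>
        stepScale d Lc j * (((box (d + 1) Lc).card : ℝ) * tgrad M' (a.1, Sum.inl a.2) t.1))
    (Q₁₀ : Matrix (↥(pbox M') × Fin (d + 1)) (↥(pbox (fine Lc M')) × Fin (d + 1)) ℝ) (h : ↥(pbox (fine Lc M')) × Fin (d + 1) → ℝ) :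
    (∑ b : ↥(pbox (fine Lc M')) × Fin (d + 1), h b •
        ∑ a' : ↥(pbox M') × Fin (d + 1), (stepScale d Lc (j + 1) / (stepScale d Lc j ^ 2 * ((box (d + 1) Lc).card : ℝ)) * Q₁₀ a' b) •
          (perF M' (dper M' (symVhSAt (ctr (d + 1) Lc) d Lc rfl a'.2 (a'.1 : Site (d + 1))))).submatrix (fun a : κI => ((pμ' a, Sum.inr (mμ' a)) : Idx M' (Fib d)))
            (fun b : ↥(pbox M') × Fin (d + 1) => ((b.1, Sum.inl b.2) : Idx M' (Fib d)))) * Dbar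
        + Q₂₀ * ∑ b : ↥(pbox (fine Lc M')) × Fin (d + 1), h b •
            Matrix.of (fun (a : ↥(pbox M') × Fin (d + 1)) (t : Res (ctr (d + 1) Lc) Lc M') =>
              -((((Lc : ℝ) ^ (d + 1) * stepScale d Lc j)⁻¹) * Q₁₀ a b * tdelta M' ((a.1 : Site (d + 1)) + unitVec a.2) t.1)) = 0 := by
  rw [sum_smul_mul, Matrix.mul_sum, ← Finset.sum_add_distrib]
  refine Finset.sum_eq_zero fun b _ => ?_
  rw [Matrix.mul_smul, ← smul_add, torus_d1_symVhSAt M' hM' j pμ' mμ' hQ₂₀ hDbar Q₁₀ b, smul_zero]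

end D1

end Summit.QuantumFields.BalabanUV.Beta.FP.PeriodisedSymCoarseWardContact

end
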